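import Literature.AnabelianGeometry.SemiGraphs.OneVertexWitnessChart
import Literature.AnabelianGeometry.SemiGraphs.TemperedSpecialFibreTower
import Literature.GroupTheory.SpecificGroups.PadicAffineGroupCharacteristic
import HarnessLib

/-!
# Non-vacuity of the special-fibre tower interface `SpecialFibreTower` ([SemiAnbd] Example 3.10, pp. 44–45)

Mochizuki, *Semi-graphs of anabelioids*, Publ. RIMS **42** (2006), §3, Example 3.10, manuscript p. 44
[cite: MochizukiSemiAnbd2006, Ex 3.10 p.44] ("an exhaustive sequence of open characteristic [hence normal]
subgroups of finite index … `⊆ N_i ⊆ … ⊆ Δ` … `N_i` determines a finite log étale covering … whose geometric special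
fiber gives rise to semi-graphs of anabelioids `𝒢_i` … `Δ ↠ … ↠ Δ[i] := π₁^temp(𝒢_i) ⋊^out Δ_i ↠ …`") — typed by seat
abc-iut-w5-d122 as the INTERFACE structure `SpecialFibreTower Δ` (`TemperedSpecialFibreTower.lean`, fields `N`,
`N_char`, `N_exhaustive`, `Gc`, `hyp`, `chart`, `admKer`, `adm`, `faithful`, …) over the [SemiAnbd] §3 interface of
seat abc-iut-L3-t2.

PROOF-ONLY file (abc-iut cell §4(iii) non-vacuity lane, row NV-L3/SpecialFibreTower; seat abc-iut-L3-t2 gen 3; no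
definition, no named fact): the field set of `SpecialFibreTower Δ` is JOINTLY SATISFIABLE at `Δ := Aff(ℤ_p)`
(`PadicAffine p`), `p` ODD, with every [SemiAnbd] ingredient GENUINE at its level: `N_i := Γ_i` the congruence
subgroups (open, normal, of finite index, exhaustive, and CHARACTERISTIC — seat abc-iut-w5-d212's
`PadicAffine.level_char`, `PadicAffineGroupCharacteristic.lean`: for odd `p` the translations are the commutator
subgroup and `Γ_i` is the preimage of the centre modulo `p^i`-th powers of translations); `𝒢_i :=` the one-vertex edgeless semi-graph of
anabelioids with vertex group `Γ_i` (seat abc-iut-L3-t2's generic `OneVertex.graph`, satisfying the hypotheses of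
Thm. 3.7 because `Γ_i` is slim with the congruence level family); `chart i :=` its explicit chart `π₁^temp(𝒢_i) = Γ_i`;
`adm i := id`, `admKer i := 1` (so `Δ[i] = Δ`), and `faithful` = slimness of `Aff(ℤ_p)`.  HONEST LIMITS: consistency
evidence only — nothing here is the special-fibre tower of a curve; the origin statement `Ex310TowerStatement` and the
certificate `SpecialFibreOrigin.IsSpecialFibreOf` are NOT claimed; the structure has no arithmetic side.  No statement of
the paper is asserted; nothing here bears on [IUTchIII] Cor. 3.12.
-/

noncomputable section

namespace Literature.AnabelianGeometry.SemiGraphs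

open Literature.AlgebraicGeometry.Frobenioids (IsSlimGroup)
open Literature.GroupTheory.SpecificGroups
open Literature.GroupTheory.SpecificGroups.PadicAffine (level I mem_level_iff isOpen_level)
open ProfiniteSemiGraph Topology

namespace SpecialFibreTowerWitness

variable {p : ℕ} [Fact p.Prime]

/-! ### The congruence subgroups: antitone, finite index, exhaustive -/

/-- `Γ_{n+1} ≤ Γ_n`. [cite: MochizukiSemiAnbd2006, §0 p.6] -/
theorem level_antitone : Antitone (level p) := by
  refine antitone_nat_of_succ_le fun n g hg => ?_
  have hI : I p (n + 1) ≤ I p n :=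
    Ideal.span_singleton_le_span_singleton.mpr (pow_dvd_pow _ (Nat.le_succ n))
  exact ⟨hI hg.1, hI hg.2⟩

/-- An element of `ℤ_p` lying in every `p^nℤ_p` is `0`. [folklore] -/
private theorem eq_zero_of_forall_mem_I {z : ℤ_[p]} (h : ∀ n, z ∈ I p n) : z = 0 := by
  by_contra hz
  have hpos : 0 < ‖z‖ := norm_pos_iff.mpr hz
  have hp1 : (1 : ℝ) < p := Nat.one_lt_cast.mpr (Fact.out : p.Prime).one_lt
  obtain ⟨n, hn⟩ := exists_pow_lt_of_lt_one hpos (inv_lt_one_of_one_lt₀ hp1)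
  have hle := (PadicAffine.mem_I_iff_norm n z).mp (h n)
  rw [zpow_neg, zpow_natCast, ← inv_pow] at hle
  exact lt_irrefl _ (hle.trans_lt hn)

/-- `⋂_i Γ_i = {1}`. [cite: MochizukiSemiAnbd2006, §0 p.6] -/
theorem eq_one_of_forall_mem_level {g : PadicAffine p} (h : ∀ n, g ∈ level p n) : g = 1 := by
  have ha : g.a = 0 := eq_zero_of_forall_mem_I fun n => (h n).1
  have hu : (g.u : ℤ_[p]) - 1 = 0 := eq_zero_of_forall_mem_I fun n => (h n).2
  ext
  · rw [ha, PadicAffine.one_a]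
  · rw [PadicAffine.one_u, Units.val_one]; exact sub_eq_zero.mp hu

/-- `Γ_n` has finite index. [cite: MochizukiSemiAnbd2006, §0 p.6] -/
theorem finiteIndex_level (n : ℕ) : (level p n).FiniteIndex :=
  haveI := PadicAffine.finite_quotient_level (p := p) n
  Subgroup.finiteIndex_of_finite_quotient

/-- `p^n ≤ [Aff(ℤ_p) : Γ_n]`. [cite: MochizukiSemiAnbd2006, §0 p.6] -/
theorem pow_le_index_level (n : ℕ) : p ^ n ≤ (level p n).index := by
  rw [Subgroup.index_eq_card]; exact PadicAffine.pow_le_card_quotient_level n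

/-! ### `Γ_i` as a profinite slim group with its own congruence level family -/

/-- An open subgroup of a slim group is slim (centralisers of its open subgroups are centralisers of open subgroups
of the ambient group). [cite: MochizukiSemiAnbd2006, §0 p.6] -/
private theorem isSlimGroup_subgroup {G : Type} [Group G] [TopologicalSpace G] [ContinuousMul G]
    (hG : IsSlimGroup G) (H : Subgroup G) (hH : IsOpen (H : Set G)) : IsSlimGroup H := by
  refine ⟨fun U hU => ?_⟩
  have hUo : IsOpen ((U.map H.subtype : Subgroup G) : Set G) := by
    have : ((U.map H.subtype : Subgroup G) : Set G) = Subtype.val '' (U : Set H) := by ext x; simp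
    rw [this]
    exact hH.isOpenMap_subtype_val _ hU
  have hc := hG.centralizer_eq_bot _ hUo
  refine (Subgroup.eq_bot_iff_forall _).mpr fun c hc' => ?_
  have hcG : (c : G) ∈ Subgroup.centralizer ((U.map H.subtype : Subgroup G) : Set G) := by
    rw [Subgroup.mem_centralizer_iff]
    rintro _ ⟨u, hu, rfl⟩
    exact congrArg Subtype.val (Subgroup.mem_centralizer_iff.mp hc' u hu)
  rw [hc] at hcG
  exact Subtype.ext (Subgroup.mem_bot.mp hcG)

/-- `Γ_i` is slim. [cite: MochizukiSemiAnbd2006, §0 p.6] -/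
theorem isSlimGroup_level (i : ℕ) : IsSlimGroup (level p i) :=
  isSlimGroup_subgroup ⟨PadicAffine.centralizer_eq_bot_of_isOpen⟩ _ (isOpen_level i)

/-- `Γ_i` is compact (a closed subgroup of the profinite `Aff(ℤ_p)`). [cite: MochizukiSemiAnbd2006, §0 p.6] -/
theorem compactSpace_level (i : ℕ) : CompactSpace (level p i) :=
  isCompact_iff_compactSpace.mp ((level p i).isClosed_of_isOpen (isOpen_level i)).isCompact

/-- The relative index `[Γ_i : Γ_{n+i}]`, times `[Aff(ℤ_p) : Γ_i]`, is `[Aff(ℤ_p) : Γ_{n+i}] ≥ p^{n+i}`; hence the level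
quotients of `Γ_i` have unbounded order. [cite: MochizukiSemiAnbd2006, §0 p.6] -/
theorem exists_le_relIndex_level (i M : ℕ) :
    ∃ n, M ≤ Nat.card (level p i ⧸ (level p (n + i)).subgroupOf (level p i)) := by
  haveI := finiteIndex_level (p := p) i
  have hpos : 0 < (level p i).index := Nat.pos_of_ne_zero Subgroup.FiniteIndex.index_ne_zero
  have hp1 : 1 < p := (Fact.out : p.Prime).one_lt
  -- choose `n` with `M * [A : Γ_i] ≤ p^(n+i)`
  obtain ⟨n, hn⟩ : ∃ n : ℕ, M * (level p i).index ≤ p ^ (n + i) :=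
    ⟨M * (level p i).index, ((Nat.lt_pow_self hp1).le).trans
      (Nat.pow_le_pow_right hp1.le (Nat.le_add_right _ _))⟩
  refine ⟨n, ?_⟩
  have hmul := Subgroup.relIndex_mul_index (H := level p (n + i)) (K := level p i)
    (level_antitone (Nat.le_add_left i n))
  have hidx := pow_le_index_level (p := p) (n + i)
  change M ≤ (level p (n + i)).relIndex (level p i)
  by_contra hlt
  have hlt' : (level p (n + i)).relIndex (level p i) < M := Nat.lt_of_not_le hlt
  have : (level p (n + i)).index < M * (level p i).index := by
    rw [← hmul]; exact Nat.mul_lt_mul_of_pos_right hlt' hpos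
  omega

/-- The congruence subgroups `Γ_{n+i} ≤ Γ_i` form a level family of the profinite group `Γ_i`.
(Stated as an existence so that this file stays proof-only.) [cite: MochizukiSemiAnbd2006, §0 p.6] -/
theorem nonempty_levelFamily_level (i : ℕ) : Nonempty (ProfiniteSemiGraph.LevelFamily (level p i)) := by
  refine ⟨{ N := fun n => (level p (n + i)).subgroupOf (level p i)
            normal := fun n => (PadicAffine.level_normal (n + i)).subgroupOf _
            isOpen := fun n => ?_
            finiteQuotient := fun n => ?_
            basis := fun U hU h1 => ?_
            unbounded := fun M => exists_le_relIndex_level i M }⟩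
  · rw [Subgroup.coe_subgroupOf]
    exact (isOpen_level (n + i)).preimage continuous_subtype_val
  · haveI := finiteIndex_level (p := p) (n + i)
    haveI : ((level p (n + i)).subgroupOf (level p i)).FiniteIndex := by
      refine ⟨fun h0 => ?_⟩
      have hmul := Subgroup.relIndex_mul_index (H := level p (n + i)) (K := level p i)
        (level_antitone (Nat.le_add_left i n))
      change (level p (n + i)).relIndex (level p i) = 0 at h0
      rw [h0, zero_mul] at hmul
      exact Subgroup.FiniteIndex.index_ne_zero hmul.symm
    exact Subgroup.finite_quotient_of_finiteIndex
  · obtain ⟨V, hV, rfl⟩ := isOpen_induced_iff.mp hU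
    obtain ⟨m, -, hm⟩ := PadicAffine.exists_level_subset hV h1
    refine ⟨m, fun x hx => ?_⟩
    exact hm (level_antitone (Nat.le_add_right m i) hx)

/-! ### The tower -/

/-- **NON-VACUITY of `SpecialFibreTower`** ([SemiAnbd] Ex. 3.10 p. 44 as typed) at `Δ := Aff(ℤ_p)`, `p` odd: the
congruence tower `N_i := Γ_i` (characteristic, open, normal, finite index, exhaustive) with, at each level, the
GENUINE one-vertex semi-graph of anabelioids `B(Γ_i)` satisfying the hypotheses of Thm. 3.7, its explicit tempered
fundamental group chart `π₁^temp = Γ_i`, the admissible quotient `Γ_i ↠ π₁^temp(𝒢_i)` the identity (kernel `1`), and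
faithfulness from the slimness of `Aff(ℤ_p)`.  Consistency evidence only (no origin certificate; not the tower of a
curve). [cite: MochizukiSemiAnbd2006, Ex 3.10 p.44] -/
theorem nonempty_specialFibreTower_padicAffine (hp : p ≠ 2) : Nonempty (SpecialFibreTower (PadicAffine p)) := by
  haveI : SecondCountableTopology (PadicAffine p) := secondCountableTopology_padicAffine
  haveI hsc : ∀ i : ℕ, SecondCountableTopology (level p i) :=
    fun i => TopologicalSpace.Subtype.secondCountableTopology _
  haveI hcpt : ∀ i : ℕ, CompactSpace (level p i) := compactSpace_level
  have L : ∀ i : ℕ, ProfiniteSemiGraph.LevelFamily (level p i) :=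
    fun i => Classical.choice (nonempty_levelFamily_level i)
  refine ⟨{ N := level p
            N_antitone := level_antitone
            isOpen_N := isOpen_level
            N_char := PadicAffine.level_char hp
            N_normal := PadicAffine.level_normal
            N_finiteIndex := finiteIndex_level
            N_exhaustive := fun g hg => eq_one_of_forall_mem_level hg
            Gc := fun i => OneVertex.graph (level p i)
            hyp := fun i => OneVertex.thm37Hypotheses (L i) (isSlimGroup_level i)
            chart := fun i => OneVertex.chart (L i)
            admKer := fun _ => ⊥
            admKer_le := fun _ => bot_le
            admKer_normal := fun _ => inferInstance
            admKer_antitone := fun _ _ _ => le_rfl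
            adm := fun i => ContinuousMonoidHom.id _
            adm_surjective := fun i => Function.surjective_id
            isOpenMap_adm := fun i => IsOpenMap.id
            ker_adm := fun i => ?_
            faithful := fun i g hg => ?_ }⟩
  · -- `Ker id = 1 = 1 ∩ Γ_i`
    rw [Subgroup.bot_subgroupOf]
    exact (MonoidHom.ker_eq_bot_iff _).mpr Function.injective_id
  · -- an element centralising the open `Γ_i` is trivial (slimness of `Aff(ℤ_p)`), so lies in `Γ_i`
    have hz : g ∈ Subgroup.centralizer (level p i : Set (PadicAffine p)) := by
      rw [Subgroup.mem_centralizer_iff]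
      intro n hn
      have h := hg n hn
      rw [Subgroup.mem_bot] at h
      -- h : g * n * g⁻¹ * n⁻¹ = 1
      have : g * n = n * g := by
        calc g * n = g * n * g⁻¹ * n⁻¹ * (n * g) := by group
          _ = n * g := by rw [h, one_mul]
      exact this.symm
    rw [PadicAffine.centralizer_eq_bot_of_isOpen _ (isOpen_level i), Subgroup.mem_bot] at hz
    rw [hz]; exact (level p i).one_mem

/-- The same as an existence over the interface's base: some topological group carries a special-fibre tower whose
semi-graphs, charts and admissible quotients are genuine [SemiAnbd] objects. [cite: MochizukiSemiAnbd2006, Ex 3.10 p.44] -/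
theorem exists_specialFibreTower :
    ∃ (Δ : Type) (_ : Group Δ) (_ : TopologicalSpace Δ), Nonempty (SpecialFibreTower Δ) :=
  ⟨PadicAffine 3, inferInstance, inferInstance,
    @nonempty_specialFibreTower_padicAffine 3 ⟨Nat.prime_three⟩ (by decide)⟩

end SpecialFibreTowerWitness

end Literature.AnabelianGeometry.SemiGraphs

end
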